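import Summits.MatrixMultiplication.OmegaCensus.DominoZpZpConsist
import Summits.MatrixMultiplication.OmegaCensus.DominoZ5Z5Consist11x28RowsA
import Summits.MatrixMultiplication.OmegaCensus.DominoZ5Z5Consist11x28RowsB
import Summits.MatrixMultiplication.OmegaCensus.DominoZ5Z5Part8
import HarnessLib

/-!
# No domino cube law with a part of size `11` over any `A ↠ ℤ_5 × ℤ_5` with `|A| = 925`: census cell `(1,11,28)@925`

ω-census `pub-omega`, family (b3), seat pub-omega-group gen 27.  Framing: lottery ticket; floor = certified bounds/negative
ranges.  VALUE: kernel instance data of the moment-consistency route (`DominoZpZpConsist*.lean`, G5 of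
`HOME/pub-omega-group-g26/FAMILY-B-ADDENDUM-g26.md`) for the census cell `(1,11,28)@925` (`A ↠ ℤ_5 × ℤ_5`, `|A| = 925 = 5·185`);
NOT progress on ω.  Generated by `HOME/pub-omega-group-g27/code/gen_cell.py` from the exact line census of gen 26
(`table_p5_d11_e28.json`, engines E1 = E2), every certificate re-verified by independent integer arithmetic before emission.

Assembly: `no_law_cube_1de_of_onto_zpzp_of_consist` / `no_law_cube_1d_e_of_onto_zpzp_of_consist` (`DominoZpZpConsist.lean`) with
`M = 4`, `K = 185`, the table checks of `DominoZ5Z5Consist11x28Table.lean` (`tabZ5d11_ok`, `complZ5d11`, `repZ5d11`, `invZ5d11`) and the row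
verdicts of `DominoZ5Z5Consist11x28Rows*.lean`.  Cells `no_law_cube_1_11_e_of_onto_z5z5_card925` / `no_law_cube_1_d_11_of_onto_z5z5_card925`:
no `(1,1 | 11,11 | e,e)` (resp. `(1,1 | d,d | 11,11)`) law triple in any dihedral-like group (any `c₀`) over ANY finite abelian
`A` of order 925 with `A ↠ ℤ_5 × ℤ_5` — census cell `(1,11,28)@925`, both orders.
-/

namespace Summit.MatrixMultiplication.OmegaCensus

open Finset ZpZpDomino Literature.Combinatorics.Additive

namespace ZpZpDomino

/-- **All row verdicts**: every pivot pair `(T₀, T₁) ∈ l0Z5d11²` is dead. [folklore] -/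
theorem rowsZ5d11_all : ∀ T₀ ∈ l0Z5d11, rowDead 5 4 (expandLst 5 (lstOfTable tabZ5d11)) l0Z5d11 T₀ = true := by
  intro T hm
  rw [show l0Z5d11 = rZ5d11_1 ++ rZ5d11_2 ++ rZ5d11_3 ++ rZ5d11_4 ++ rZ5d11_5 ++ rZ5d11_6 from rfl] at hm
  rcases List.mem_append.1 hm with hm | hm
  · rcases List.mem_append.1 hm with hm | hm
    · rcases List.mem_append.1 hm with hm | hm
      · rcases List.mem_append.1 hm with hm | hm
        · rcases List.mem_append.1 hm with hm | hm
          · exact List.all_eq_true.1 rows_rZ5d11_1 T hm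
          · exact List.all_eq_true.1 rows_rZ5d11_2 T hm
        · exact List.all_eq_true.1 rows_rZ5d11_3 T hm
      · exact List.all_eq_true.1 rows_rZ5d11_4 T hm
    · exact List.all_eq_true.1 rows_rZ5d11_5 T hm
  · exact List.all_eq_true.1 rows_rZ5d11_6 T hm

end ZpZpDomino

variable {A : Type} [AddCommGroup A] [DecidableEq A] [Fintype A] {G : Type} [Group G] [DecidableEq G]
  {ρ τ : A → G} {c₀ : A} {S T U : Finset G}

/-- **No `(1,1 | 11,11 | e,e)` law triple over `A ↠ ℤ_5 × ℤ_5`, `|A| = 925`** (dihedral-like `G`, any `c₀`, `φ` onto):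
census cell `(1,11,28)@925`. [folklore] -/
theorem no_law_cube_1_11_e_of_onto_z5z5_card925
    (hρρ : ∀ a b, ρ a * ρ b = ρ (a + b)) (hρτ : ∀ a b, ρ a * τ b = τ (b - a))
    (hτρ : ∀ a b, τ a * ρ b = τ (a + b)) (hττ : ∀ a b, τ a * τ b = ρ (c₀ + b - a))
    (hρ : Function.Injective ρ) (hτ : Function.Injective τ) (hne : ∀ a b, ρ a ≠ τ b)
    (hsurj : ∀ g, (∃ a, ρ a = g) ∨ (∃ a, τ a = g))
    (φ : A →+ ZMod 5 × ZMod 5) (hφ : Function.Surjective φ) (hA : Fintype.card A = 925)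
    (h : TripleProductProperty S T U)
    (hS₀ : (univ.filter fun a : A => ρ a ∈ S).card = 1) (hS₁ : (univ.filter fun a : A => τ a ∈ S).card = 1)
    (hT₀ : (univ.filter fun a : A => ρ a ∈ T).card = 11) (hT₁ : (univ.filter fun a : A => τ a ∈ T).card = 11)
    (hU : (univ.filter fun a : A => ρ a ∈ U).card = (univ.filter fun a : A => τ a ∈ U).card)
    (hV : 3 * (S.card * T.card * U.card) + 8 = 8 * Fintype.card A) : False :=
  haveI : Fact (Nat.Prime 5) := ⟨by decide⟩
  no_law_cube_1de_of_onto_zpzp_of_consist (3 : ZMod 5) half_zmod5 (d := 11) (K := 185) (M := 4)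
    (expandLst 5 (lstOfTable tabZ5d11)) l0Z5d11 ⟨by decide, by decide⟩ invZ5d11 rowsZ5d11_all
    (complete_of_checks (by decide) tabZ5d11_ok complZ5d11) (rep_of_repCheck repZ5d11)
    hρρ hρτ hτρ hττ hρ hτ hne hsurj φ hφ (by rw [hA]) h hS₀ hS₁ hT₀ hT₁ hU hV

/-- **No `(1,1 | d,d | 11,11)` law triple over `A ↠ ℤ_5 × ℤ_5`, `|A| = 925`** (dihedral-like `G`, any `c₀`, `φ` onto):
census cell `(1,11,28)@925`, parts swapped. [folklore] -/
theorem no_law_cube_1_d_11_of_onto_z5z5_card925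
    (hρρ : ∀ a b, ρ a * ρ b = ρ (a + b)) (hρτ : ∀ a b, ρ a * τ b = τ (b - a))
    (hτρ : ∀ a b, τ a * ρ b = τ (a + b)) (hττ : ∀ a b, τ a * τ b = ρ (c₀ + b - a))
    (hρ : Function.Injective ρ) (hτ : Function.Injective τ) (hne : ∀ a b, ρ a ≠ τ b)
    (hsurj : ∀ g, (∃ a, ρ a = g) ∨ (∃ a, τ a = g))
    (φ : A →+ ZMod 5 × ZMod 5) (hφ : Function.Surjective φ) (hA : Fintype.card A = 925)
    (h : TripleProductProperty S T U)
    (hS₀ : (univ.filter fun a : A => ρ a ∈ S).card = 1) (hS₁ : (univ.filter fun a : A => τ a ∈ S).card = 1)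
    (hT : (univ.filter fun a : A => ρ a ∈ T).card = (univ.filter fun a : A => τ a ∈ T).card)
    (hU₀ : (univ.filter fun a : A => ρ a ∈ U).card = 11) (hU₁ : (univ.filter fun a : A => τ a ∈ U).card = 11)
    (hV : 3 * (S.card * T.card * U.card) + 8 = 8 * Fintype.card A) : False :=
  haveI : Fact (Nat.Prime 5) := ⟨by decide⟩
  no_law_cube_1d_e_of_onto_zpzp_of_consist (3 : ZMod 5) half_zmod5 (e := 11) (K := 185) (M := 4)
    (expandLst 5 (lstOfTable tabZ5d11)) l0Z5d11 ⟨by decide, by decide⟩ invZ5d11 rowsZ5d11_all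
    (complete_of_checks (by decide) tabZ5d11_ok complZ5d11) (rep_of_repCheck repZ5d11)
    hρρ hρτ hτρ hττ hρ hτ hne hsurj φ hφ (by rw [hA]) h hS₀ hS₁ hT hU₀ hU₁ hV

end Summit.MatrixMultiplication.OmegaCensus
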